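import Summits.ValiantsHypothesis.ValiantsHypothesis.Theorems.BarrierLeverAnchoredDoorHitsLowerPairsGraphPairs

/-!
# Support item `AnchoredDoorHitsLowerPairs` (stmt-ValiantsHypothesis-22510), line `anchored-peeling`:
# THIN VERTEX STEP, part 5 — the SDR form (no simplicial-complex hypothesis) and the TOTAL-NONSINGULARITY induction skeleton

Helper file (`--supports stmt-ValiantsHypothesis-22510`; cell valiant-natproofs, rung V4, 𝒟-side door (c); registered line
`Cruxes/AnchoredDoorHitsLowerPairs/Lines/anchored_peeling.lean` v5; prover seat val-np-p2 gen 11). Definition-free. Closes NO item.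

CONTEXT (seat memo HOME/val-np-p2/g11/TU1-valnp2-g11.md, evidence #43 on 22510). The census suggests **conjecture TU1**: the layout matrix of
𝔄₁ on ALL nonempty faces is TOTALLY NONSINGULAR — 𝔄₁ hits every equal-size pair `(R, C)` of face families with `∅ ∈ R ⟺ ∅ ∈ C`, lower set
or not (all minors at supports ≤ (3,3); 409 526 minors at (4,4) incl. all of size ≤ 3 and ≥ 13; 88 962 at (5,5); 0 singular). TU1 ⟹ U1 ⟹
`stub_vertexStep`. This file supplies the two kernel pieces of a TU1 induction that do not depend on the conjecture:

* `symbolicDet_ne_zero_of_thin_sdr` — **the thin vertex step in SDR form** (every `s ≥ 1`, every `h`, ARBITRARY injective row and column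
  families with matched emptiness): if the link rows through `a` can be assigned DISTINCT columns `w (τ i)` with DISTINCT representatives
  `c i ∈ w (τ i)` (a system of distinct representatives — no «upper», no «{c} is a column», no lower sets), and the deletion rows are
  nonsingular against every equal-size sub-family of the columns with matched emptiness, then `symbolicDet s h r u w ≠ 0`
  (part 3's aligned design theorem + a column permutation);
* `symbolicDet_one_ne_zero_of_totalStep` — **the induction skeleton**: if the TU1-shaped vertex step holds at every vertex of every
  configuration (hypothesis `H`, the total analogue of `Stmt.stub_vertexStep`), then 𝔄₁ hits every equal-size pair with matched emptiness,
  at every `h` (strong induction on `r`; base `r ≤ 1` = `stub_base`).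
So a proof of `H` at the THICK vertices (those without an SDR; e.g. `(K_5, 2^{[4]})`) would give TU1, hence the item.

WHAT THIS IS NOT: TU1 is a CONJECTURE (census evidence only); nothing here proves it, nothing on items 22510 / 19717 themselves, on crux
stmt-ValiantsHypothesis-14610, or on `VP` versus `VNP`.
-/

set_option linter.dupNamespace false

namespace Summit.ValiantsHypothesis.ValiantsHypothesis.Theorems.BarrierLever.AnchoredPeeling

open Finset MvPolynomial
open Summit.ValiantsHypothesis.ValiantsHypothesis.Theorems.BarrierLever.BrickCalculus (pexpo)

noncomputable section

namespace ThinStep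

variable {h : ℕ}

/-! ## 1. The deletion block from a matched-emptiness hypothesis -/

/-- The deletion block is nonsingular as soon as the TU1-shaped deletion hypothesis holds and the block has matched emptiness. -/
theorem det_deletionBlock_ne_zero_of_hyp' {s r : ℕ} {u w : Fin r → Finset (Fin h)} (hu : Function.Injective u)
    (hw : Function.Injective w) (a : Fin h)
    (hmatch : (∃ i, a ∉ u i ∧ u i = ∅) ↔ (∃ j, a ∉ u j ∧ w j = ∅))
    (hdel : ∀ (r₀ : ℕ) (u₀ w₀ : Fin r₀ → Finset (Fin h)), Function.Injective u₀ → Function.Injective w₀ →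
      Set.range u₀ = {S | S ∈ Set.range u ∧ a ∉ S} → Set.range w₀ ⊆ Set.range w →
      ((∅ : Finset (Fin h)) ∈ Set.range u₀ ↔ (∅ : Finset (Fin h)) ∈ Set.range w₀) →
      symbolicDet s h r₀ u₀ w₀ ≠ 0) :
    (Matrix.of fun i j : {i : Fin r // a ∉ u i} => coeff (pexpo (u i.1) (w j.1)) (symbolicWitness s h)).det ≠ 0 := by
  classical
  set e := Fintype.equivFin {i : Fin r // a ∉ u i} with he
  have hrange_u : Set.range (fun k => u (e.symm k).1) = {S | S ∈ Set.range u ∧ a ∉ S} := by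
    ext S
    constructor
    · rintro ⟨k, rfl⟩
      exact ⟨⟨(e.symm k).1, rfl⟩, (e.symm k).2⟩
    · rintro ⟨⟨i, rfl⟩, hi⟩
      exact ⟨e ⟨i, hi⟩, by simp only [Equiv.symm_apply_apply]⟩
  have hrange_w : Set.range (fun k => w (e.symm k).1) = {T | ∃ j, a ∉ u j ∧ w j = T} := by
    ext T
    constructor
    · rintro ⟨k, rfl⟩
      exact ⟨(e.symm k).1, (e.symm k).2, rfl⟩
    · rintro ⟨j, hj, rfl⟩
      exact ⟨e ⟨j, hj⟩, by simp only [Equiv.symm_apply_apply]⟩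
  have key := hdel (Fintype.card {i : Fin r // a ∉ u i}) (fun k => u (e.symm k).1) (fun k => w (e.symm k).1)
    (hu.comp (Subtype.val_injective.comp e.symm.injective)) (hw.comp (Subtype.val_injective.comp e.symm.injective))
    hrange_u ?_ ?_
  · have hsub : symbolicDet s h _ (fun k => u (e.symm k).1) (fun k => w (e.symm k).1) =
        ((Matrix.of fun i j : {i : Fin r // a ∉ u i} =>
          coeff (pexpo (u i.1) (w j.1)) (symbolicWitness s h)).submatrix e.symm e.symm).det := rfl
    rwa [hsub, Matrix.det_submatrix_equiv_self] at key
  · rw [hrange_w]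
    rintro T ⟨j, -, rfl⟩
    exact ⟨j, rfl⟩
  · rw [hrange_u, hrange_w]
    constructor
    · rintro ⟨⟨i, hi⟩, hia⟩
      obtain ⟨j, hj, hjw⟩ := hmatch.mp ⟨i, by rw [hi]; exact Finset.notMem_empty a, hi⟩
      exact ⟨j, hj, hjw⟩
    · rintro ⟨j, hj, hjw⟩
      obtain ⟨i, hi, hiu⟩ := hmatch.mpr ⟨j, hj, hjw⟩
      exact ⟨⟨i, hiu⟩, Finset.notMem_empty a⟩

/-! ## 2. The thin vertex step in SDR form -/

/-- **The thin vertex step, SDR form** (see the module docstring). The SDR is given by `τ` (the column serving each link row) and `c`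
(its representative); their values on non-link rows are irrelevant. -/
theorem symbolicDet_ne_zero_of_thin_sdr (s h r : ℕ) (hs : 1 ≤ s) (u w : Fin r → Finset (Fin h))
    (hu : Function.Injective u) (hw : Function.Injective w)
    (hmatch : (∅ : Finset (Fin h)) ∈ Set.range u ↔ (∅ : Finset (Fin h)) ∈ Set.range w) (a : Fin h)
    (τ : Fin r → Fin r) (c : Fin r → Fin h) (hcτ : ∀ i, a ∈ u i → c i ∈ w (τ i))
    (hτinj : ∀ i i', a ∈ u i → a ∈ u i' → τ i = τ i' → i = i')
    (hcinj : ∀ i i', a ∈ u i → a ∈ u i' → c i = c i' → i = i')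
    (hdel : ∀ (r₀ : ℕ) (u₀ w₀ : Fin r₀ → Finset (Fin h)), Function.Injective u₀ → Function.Injective w₀ →
      Set.range u₀ = {S | S ∈ Set.range u ∧ a ∉ S} → Set.range w₀ ⊆ Set.range w →
      ((∅ : Finset (Fin h)) ∈ Set.range u₀ ↔ (∅ : Finset (Fin h)) ∈ Set.range w₀) →
      symbolicDet s h r₀ u₀ w₀ ≠ 0) :
    symbolicDet s h r u w ≠ 0 := by
  classical
  -- the column permutation aligning link row `i` with column `τ i`
  let q : Fin r → Prop := fun j => ∃ i, a ∈ u i ∧ τ i = j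
  let β₀ : {i : Fin r // a ∈ u i} → {j : Fin r // q j} := fun i => ⟨τ i.1, i.1, i.2, rfl⟩
  have hβ₀ : Function.Bijective β₀ := by
    refine ⟨fun i i' hii' => Subtype.ext (hτinj _ _ i.2 i'.2 (congrArg Subtype.val hii')), fun j => ?_⟩
    obtain ⟨i, hi, hij⟩ := j.2
    exact ⟨⟨i, hi⟩, Subtype.ext hij⟩
  set β : {i : Fin r // a ∈ u i} ≃ {j : Fin r // q j} := Equiv.ofBijective β₀ hβ₀ with hβ
  set π : Equiv.Perm (Fin r) := β.extendSubtype with hπ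
  have hπlink : ∀ i, a ∈ u i → π i = τ i := fun i hi => by
    rw [hπ, β.extendSubtype_apply_of_mem i hi, hβ, Equiv.ofBijective_apply]
  have hπnot : ∀ i, a ∉ u i → ¬ q (π i) := fun i hi => β.extendSubtype_not_mem i hi
  apply symbolicDet_ne_zero_of_perm s h r u w π
  -- the design on `(u, w ∘ π)`
  set w' : Fin r → Finset (Fin h) := w ∘ π with hw'
  have hw'i : Function.Injective w' := hw.comp π.injective
  have hw'val : ∀ i, w' i = w (π i) := fun i => rfl
  let Sx : Fin h → Finset (Fin h) := fun d =>
    if hd : ∃ i, a ∈ u i ∧ c i = d then (u (Classical.choose hd)).erase a else ∅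
  let τ' : Fin h → Finset (Fin h) := fun d =>
    if hd : ∃ i, a ∈ u i ∧ c i = d then w' (Classical.choose hd) else ∅
  set D : Finset (Fin h) := (Finset.univ.filter (fun i => a ∈ u i)).image c with hDdef
  have hSx : ∀ i, a ∈ u i → Sx (c i) = (u i).erase a := by
    intro i hi
    have hd : ∃ i', a ∈ u i' ∧ c i' = c i := ⟨i, hi, rfl⟩
    simp only [Sx, dif_pos hd]
    rw [hcinj _ _ (Classical.choose_spec hd).1 hi (Classical.choose_spec hd).2]
  have hτ' : ∀ i, a ∈ u i → τ' (c i) = w' i := by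
    intro i hi
    have hd : ∃ i', a ∈ u i' ∧ c i' = c i := ⟨i, hi, rfl⟩
    simp only [τ', dif_pos hd]
    rw [hcinj _ _ (Classical.choose_spec hd).1 hi (Classical.choose_spec hd).2]
  have hDmem : ∀ d ∈ D, ∃ i, a ∈ u i ∧ c i = d := by
    intro d hd
    obtain ⟨i, hi, rfl⟩ := Finset.mem_image.mp hd
    exact ⟨i, (Finset.mem_filter.mp hi).2, rfl⟩
  refine symbolicDet_ne_zero_of_thinDesign s h r hs u w' hw'i a D Sx τ' ?_ ?_ ?_ ?_ ?_
  · intro d hd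
    obtain ⟨i, hi, rfl⟩ := hDmem d hd
    rw [hSx i hi]; exact Finset.notMem_erase a _
  · intro d hd
    obtain ⟨i, hi, rfl⟩ := hDmem d hd
    rw [hτ' i hi, hw'val, hπlink i hi]; exact hcτ i hi
  · intro d hd d' hd' heq
    obtain ⟨i, hi, rfl⟩ := hDmem d hd
    obtain ⟨i', hi', rfl⟩ := hDmem d' hd'
    rw [hSx i hi, hSx i' hi'] at heq
    have : u i = u i' := by rw [← Finset.insert_erase hi, ← Finset.insert_erase hi', heq]
    rw [hu this]
  · intro i hi
    exact ⟨c i, Finset.mem_image.mpr ⟨i, Finset.mem_filter.mpr ⟨Finset.mem_univ _, hi⟩, rfl⟩, hSx i hi, hτ' i hi⟩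
  · -- the deletion block of `(u, w')`
    refine det_deletionBlock_ne_zero_of_hyp' hu hw'i a ?_ ?_
    · -- matched emptiness of the block
      constructor
      · rintro ⟨i, -, hi⟩
        obtain ⟨j, hj⟩ := hmatch.mp ⟨i, hi⟩
        have hqj : ¬ q j := by
          rintro ⟨i', hi', hτi'⟩
          have := hcτ i' hi'
          rw [hτi', hj] at this
          exact Finset.notMem_empty _ this
        refine ⟨π.symm j, fun hmem => hqj ?_, by rw [hw'val, Equiv.apply_symm_apply, hj]⟩
        have := hπlink (π.symm j) hmem
        rw [Equiv.apply_symm_apply] at this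
        exact ⟨π.symm j, hmem, this.symm⟩
      · rintro ⟨j, -, hj⟩
        obtain ⟨i, hi⟩ := hmatch.mpr ⟨π j, hj⟩
        exact ⟨i, by rw [hi]; exact Finset.notMem_empty a, hi⟩
    · intro r₀ u₀ w₀ hu₀ hw₀ hru₀ hrw₀ hm₀
      refine hdel r₀ u₀ w₀ hu₀ hw₀ hru₀ (hrw₀.trans ?_) hm₀
      rintro T ⟨j, rfl⟩
      exact ⟨π j, rfl⟩

/-! ## 3. The total-nonsingularity induction skeleton -/

/-- Base case: `r ≤ 1`, all rows empty, matched emptiness ⇒ the (at most `1 × 1`) minor is `1`. -/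
theorem symbolicDet_ne_zero_base {s r : ℕ} {u w : Fin r → Finset (Fin h)} (hu : Function.Injective u)
    (hw : Function.Injective w) (hmatch : (∅ : Finset (Fin h)) ∈ Set.range u ↔ (∅ : Finset (Fin h)) ∈ Set.range w)
    (hex : ∀ (i : Fin r) (a : Fin h), a ∉ u i) : symbolicDet s h r u w ≠ 0 := by
  have hr := le_one_of_no_vertex hu hex
  have hue : ∀ i, u i = ∅ := fun i => Finset.eq_empty_iff_forall_notMem.mpr (hex i)
  have hwe : ∀ j, w j = ∅ := by
    intro j
    have hr1 : r = 1 := le_antisymm hr (Fin.pos j)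
    obtain ⟨j', hj'⟩ := hmatch.mp ⟨j, hue j⟩
    have : j' = j := by subst hr1; exact Subsingleton.elim _ _
    rw [← this, hj']
  refine stub_base s h r u w hu hw ?_ ?_ hr
  · intro S T hTS ⟨i, hi⟩
    rw [hue i] at hi; rw [← hi] at hTS
    exact ⟨i, by rw [hue i]; exact (Finset.subset_empty.mp hTS).symm⟩
  · intro S T hTS ⟨j, hj⟩
    rw [hwe j] at hj; rw [← hj] at hTS
    exact ⟨j, by rw [hwe j]; exact (Finset.subset_empty.mp hTS).symm⟩

/-- **The total-nonsingularity induction skeleton.** If the TU1-shaped vertex step `H` holds at every vertex of every configuration,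
then 𝔄₁ has nonzero symbolic minor on EVERY injective equal-size pair with matched emptiness, at every `h`. -/
theorem symbolicDet_one_ne_zero_of_totalStep
    (H : ∀ (h r : ℕ) (u w : Fin r → Finset (Fin h)), Function.Injective u → Function.Injective w →
      ((∅ : Finset (Fin h)) ∈ Set.range u ↔ (∅ : Finset (Fin h)) ∈ Set.range w) →
      ∀ (a : Fin h), (∃ i, a ∈ u i) →
        (∀ (r₀ : ℕ) (u₀ w₀ : Fin r₀ → Finset (Fin h)), Function.Injective u₀ → Function.Injective w₀ →
            Set.range u₀ = {S | S ∈ Set.range u ∧ a ∉ S} → Set.range w₀ ⊆ Set.range w →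
            ((∅ : Finset (Fin h)) ∈ Set.range u₀ ↔ (∅ : Finset (Fin h)) ∈ Set.range w₀) →
            symbolicDet 1 h r₀ u₀ w₀ ≠ 0) →
        symbolicDet 1 h r u w ≠ 0) (h : ℕ) :
    ∀ (r : ℕ) (u w : Fin r → Finset (Fin h)), Function.Injective u → Function.Injective w →
      ((∅ : Finset (Fin h)) ∈ Set.range u ↔ (∅ : Finset (Fin h)) ∈ Set.range w) → symbolicDet 1 h r u w ≠ 0 := by
  intro r
  induction r using Nat.strong_induction_on with
  | _ r ih =>
    intro u w hu hw hmatch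
    by_cases hex : ∃ (i : Fin r) (a : Fin h), a ∈ u i
    · obtain ⟨i, a, hia⟩ := hex
      refine H h r u w hu hw hmatch a ⟨i, hia⟩ ?_
      intro r₀ u₀ w₀ hu₀ hw₀ hru₀ _ hm₀
      exact ih r₀ (lt_of_deletion_range hu hu₀ hia hru₀) u₀ w₀ hu₀ hw₀ hm₀
    · push Not at hex
      exact symbolicDet_ne_zero_base hu hw hmatch hex

end ThinStep

end

end Summit.ValiantsHypothesis.ValiantsHypothesis.Theorems.BarrierLever.AnchoredPeeling
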